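import Summits.Ventures.YMGap.RobustBall.BoundaryLimitDLR
import Summits.Ventures.YMGap.RobustBall.MassGapOnBallZdG
import Summits.Ventures.YMGap.RobustBall.MassGapOnBallS
import HarnessLib

/-!
# Venture YMGap, track ROBUST-BALL — ONE STATE, step 8: the finite-volume Gibbs distributions of a member with
# ARBITRARY boundary conditions converge to its one state (tier 1, tier 2, and the Wilson action itself)

HONEST FRAMING. WHAT THIS IS: a venture file (cell `pub-ymgap`, track Y2 ROBUST-BALL, seat ds-3) instantiating the
generic boundary-limit theorems of `BoundaryLimitDLR.lean` on the three carriers of the cell: rb-p1's tier-1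
specification `perturbedYM ρ β W supp` (finite-range members), the tier-2 specification `perturbedYMS ρ β W`
(link-summable, possibly infinite-range members) and the Wilson specification `ymSpecification ρ β` (`W = 0`). In
the UNIQUENESS regime (the first clause of the cell's currencies `PerturbedMassGapAt`, `PerturbedMassGapAtS`,
`MassGapAt`) the one DLR state `μ` of the member is the limit of its finite-volume Gibbs distributions
`γ^W_{Λₙ}(· | ηₙ)` along EVERY sequence of finite link volumes `Λₙ` eventually containing every finite set and for
EVERY choice of boundary fields `ηₙ ∈ G^{links(ℤ^d)}`, on every bounded continuous observable, and uniformly in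
the boundary field (`boundaryLimit_of_perturbedMassGapAt`, `boundaryLimit_onBallZdG`, `boundaryLimit_of_massGapAt`,
`boundaryLimit_of_perturbedMassGapAtS`). So the ONE STATE of `OneState.lean` (unique DLR state = periodised torus
limit) is ALSO the limit of every Dirichlet-type finite-volume prescription. CELLS by name: `OneStateBoundaryRows.lean`. WHAT THIS IS NOT: no rate of convergence (Dobrushin comparison, ds-1's
`StateLipschitz*`); the tree already has the periodic (torus) and — for Wilson — the free-boundary limits
(`tendsto_expectation_periodisedFamily_of_subsingleton`, `StrongCouplingPhaseAt`); lattice strong-coupling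
statements only, nothing about the continuum limit or the Clay Millennium problem.

References: H.-O. Georgii (2011), Thm. 4.17, Prop. 7.11; S. Friedli, Y. Velenik (2017), Lemma 6.30; the track's
`BoundaryLimitDLR.lean`, `PerturbedExistence.lean`, `SummableSpecification.lean`, `MassGapOnBall.lean`,
`MassGapOnBallZdG.lean`, `MassGapOnBallS.lean`.
-/

noncomputable section

open MeasureTheory Filter Topology Function
open Literature.Probability.LatticeModels
open Literature.MathematicalPhysics.QuantumLattice
open Literature.MathematicalPhysics.QuantumFieldTheory hiding ZdEdge

namespace Summit.Ventures.YMGap.RobustBall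

/-! ### Schemas on the three carriers (any compact second-countable gauge group) -/

section Schemas

variable {d N : ℕ} {G : Type*} [Group G] [TopologicalSpace G] [IsTopologicalGroup G] [CompactSpace G]
  [MeasurableSpace G] [BorelSpace G] [T2Space G] [SecondCountableTopology G]
  (ρ : G →* Matrix (Fin N) (Fin N) ℂ)

/-- **Tier 1: limits of finite-volume perturbed Gibbs distributions with ARBITRARY boundary conditions are DLR
states of the member** (continuous terms reading their own links, locally finite support): Georgii's Thm. 4.17 for
`perturbedYM ρ β W supp` (Feller property `continuous_integral_perturbedYM`). [folklore] -/
theorem mem_perturbedGibbsMeasures_of_tendsto (hρ : Continuous ρ) (β : ℝ) {W : Potential (ZdEdge d) G}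
    (hWc : ∀ X, Continuous (W X)) (hdep : ∀ X, DependsOn (W X) (↑X : Set (ZdEdge d)))
    {supp : Finset (ZdEdge d) → Finset (Finset (ZdEdge d))} (hsupp : W.IsSupportedBy supp)
    {Λs : ℕ → Finset (ZdEdge d)} (hcof : ∀ Δ : Finset (ZdEdge d), ∀ᶠ n in atTop, Δ ⊆ Λs n)
    (ηs : ℕ → LGConfig d G) {μ : Measure (LGConfig d G)} [IsProbabilityMeasure μ]
    (hlim : ∀ F : LGConfig d G → ℝ, Continuous F → (∃ C, ∀ U, |F U| ≤ C) →
      Tendsto (fun n => ∫ U, F U ∂(perturbedYM ρ β W supp (Λs n) (ηs n))) atTop (𝓝 (∫ U, F U ∂μ))) :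
    μ ∈ perturbedGibbsMeasures (d := d) ρ β W supp :=
  BoundaryLimit.isGibbsMeasure_of_tendsto_integral
    (isSpecification_perturbedYM ρ hρ β (fun X => ⟨hdep X, (hWc X).measurable⟩)
      (fun X => exists_bound_of_continuous (hWc X)) hsupp)
    (fun Λ _ hF _ hC => continuous_integral_perturbedYM ρ hρ β hWc supp Λ hF hC) hcof ηs hlim

/-- ★ **Tier 1, UNIQUENESS ⇒ EVERY BOUNDARY CONDITION CONVERGES TO THE ONE STATE**: if the member's DLR states
form a subsingleton containing `μ`, then `∫ F dγ^W_{Λₙ}(· | ηₙ) → ∫ F dμ` for every cofinal `(Λₙ)`, every `(ηₙ)`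
and every bounded continuous `F` (full sequence). [folklore] -/
theorem tendsto_integral_perturbedYM_of_subsingleton (hρ : Continuous ρ) (β : ℝ) {W : Potential (ZdEdge d) G}
    (hWc : ∀ X, Continuous (W X)) (hdep : ∀ X, DependsOn (W X) (↑X : Set (ZdEdge d)))
    {supp : Finset (ZdEdge d) → Finset (Finset (ZdEdge d))} (hsupp : W.IsSupportedBy supp)
    (hsub : (perturbedGibbsMeasures (d := d) ρ β W supp).Subsingleton) {μ : Measure (LGConfig d G)}
    (hμ : μ ∈ perturbedGibbsMeasures (d := d) ρ β W supp)
    {Λs : ℕ → Finset (ZdEdge d)} (hcof : ∀ Δ : Finset (ZdEdge d), ∀ᶠ n in atTop, Δ ⊆ Λs n)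
    (ηs : ℕ → LGConfig d G) {F : LGConfig d G → ℝ} (hFc : Continuous F) (hFb : ∃ C, ∀ U, |F U| ≤ C) :
    Tendsto (fun n => ∫ U, F U ∂(perturbedYM ρ β W supp (Λs n) (ηs n))) atTop (𝓝 (∫ U, F U ∂μ)) :=
  BoundaryLimit.tendsto_integral_of_subsingleton
    (isSpecification_perturbedYM ρ hρ β (fun X => ⟨hdep X, (hWc X).measurable⟩)
      (fun X => exists_bound_of_continuous (hWc X)) hsupp)
    (fun Λ _ hF _ hC => continuous_integral_perturbedYM ρ hρ β hWc supp Λ hF hC) hsub hμ hcof ηs hFc hFb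

/-- ★ **Tier 1, UNIFORMLY IN THE BOUNDARY CONDITION**: `sup_η |∫ F dγ^W_{Λₙ}(· | η) − ∫ F dμ| → 0`. [folklore] -/
theorem eventually_forall_abs_sub_integral_perturbedYM_lt (hρ : Continuous ρ) (β : ℝ)
    {W : Potential (ZdEdge d) G} (hWc : ∀ X, Continuous (W X)) (hdep : ∀ X, DependsOn (W X) (↑X : Set (ZdEdge d)))
    {supp : Finset (ZdEdge d) → Finset (Finset (ZdEdge d))} (hsupp : W.IsSupportedBy supp)
    (hsub : (perturbedGibbsMeasures (d := d) ρ β W supp).Subsingleton) {μ : Measure (LGConfig d G)}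
    (hμ : μ ∈ perturbedGibbsMeasures (d := d) ρ β W supp)
    {Λs : ℕ → Finset (ZdEdge d)} (hcof : ∀ Δ : Finset (ZdEdge d), ∀ᶠ n in atTop, Δ ⊆ Λs n)
    {F : LGConfig d G → ℝ} (hFc : Continuous F) (hFb : ∃ C, ∀ U, |F U| ≤ C) {ε : ℝ} (hε : 0 < ε) :
    ∀ᶠ n in atTop, ∀ η : LGConfig d G, |∫ U, F U ∂(perturbedYM ρ β W supp (Λs n) η) - ∫ U, F U ∂μ| < ε :=
  BoundaryLimit.eventually_forall_abs_sub_integral_lt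
    (isSpecification_perturbedYM ρ hρ β (fun X => ⟨hdep X, (hWc X).measurable⟩)
      (fun X => exists_bound_of_continuous (hWc X)) hsupp)
    (fun Λ _ hF _ hC => continuous_integral_perturbedYM ρ hρ β hWc supp Λ hF hC) hsub hμ hcof hFc hFb hε

/-- **Tier 2 (link-summable, possibly infinite-range members): limits of finite-volume Gibbs distributions with
ARBITRARY boundary conditions are DLR states** (Feller property `continuous_integral_perturbedYMS`). [folklore] -/
theorem mem_perturbedGibbsMeasuresS_of_tendsto (hρ : Continuous ρ) (β : ℝ) {W : Potential (ZdEdge d) G}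
    {B : Finset (ZdEdge d) → ℝ} (hB : IsLinkSummable W B) (hWc : ∀ X, Continuous (W X))
    (hdep : ∀ X, DependsOn (W X) (↑X : Set (ZdEdge d)))
    {Λs : ℕ → Finset (ZdEdge d)} (hcof : ∀ Δ : Finset (ZdEdge d), ∀ᶠ n in atTop, Δ ⊆ Λs n)
    (ηs : ℕ → LGConfig d G) {μ : Measure (LGConfig d G)} [IsProbabilityMeasure μ]
    (hlim : ∀ F : LGConfig d G → ℝ, Continuous F → (∃ C, ∀ U, |F U| ≤ C) →
      Tendsto (fun n => ∫ U, F U ∂(perturbedYMS ρ β W (Λs n) (ηs n))) atTop (𝓝 (∫ U, F U ∂μ))) :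
    μ ∈ perturbedGibbsMeasuresS (d := d) ρ β W :=
  BoundaryLimit.isGibbsMeasure_of_tendsto_integral (isSpecification_perturbedYMS ρ hρ β hB hWc hdep)
    (fun Λ _ hF _ hC => continuous_integral_perturbedYMS ρ hρ β hB hWc Λ hF hC) hcof ηs hlim

/-- ★ **Tier 2, UNIQUENESS ⇒ EVERY BOUNDARY CONDITION CONVERGES TO THE ONE STATE.** [folklore] -/
theorem tendsto_integral_perturbedYMS_of_subsingleton (hρ : Continuous ρ) (β : ℝ) {W : Potential (ZdEdge d) G}
    {B : Finset (ZdEdge d) → ℝ} (hB : IsLinkSummable W B) (hWc : ∀ X, Continuous (W X))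
    (hdep : ∀ X, DependsOn (W X) (↑X : Set (ZdEdge d)))
    (hsub : (perturbedGibbsMeasuresS (d := d) ρ β W).Subsingleton) {μ : Measure (LGConfig d G)}
    (hμ : μ ∈ perturbedGibbsMeasuresS (d := d) ρ β W)
    {Λs : ℕ → Finset (ZdEdge d)} (hcof : ∀ Δ : Finset (ZdEdge d), ∀ᶠ n in atTop, Δ ⊆ Λs n)
    (ηs : ℕ → LGConfig d G) {F : LGConfig d G → ℝ} (hFc : Continuous F) (hFb : ∃ C, ∀ U, |F U| ≤ C) :
    Tendsto (fun n => ∫ U, F U ∂(perturbedYMS ρ β W (Λs n) (ηs n))) atTop (𝓝 (∫ U, F U ∂μ)) :=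
  BoundaryLimit.tendsto_integral_of_subsingleton (isSpecification_perturbedYMS ρ hρ β hB hWc hdep)
    (fun Λ _ hF _ hC => continuous_integral_perturbedYMS ρ hρ β hB hWc Λ hF hC) hsub hμ hcof ηs hFc hFb

/-- ★ **Tier 2, UNIFORMLY IN THE BOUNDARY CONDITION.** [folklore] -/
theorem eventually_forall_abs_sub_integral_perturbedYMS_lt (hρ : Continuous ρ) (β : ℝ)
    {W : Potential (ZdEdge d) G} {B : Finset (ZdEdge d) → ℝ} (hB : IsLinkSummable W B)
    (hWc : ∀ X, Continuous (W X)) (hdep : ∀ X, DependsOn (W X) (↑X : Set (ZdEdge d)))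
    (hsub : (perturbedGibbsMeasuresS (d := d) ρ β W).Subsingleton) {μ : Measure (LGConfig d G)}
    (hμ : μ ∈ perturbedGibbsMeasuresS (d := d) ρ β W)
    {Λs : ℕ → Finset (ZdEdge d)} (hcof : ∀ Δ : Finset (ZdEdge d), ∀ᶠ n in atTop, Δ ⊆ Λs n)
    {F : LGConfig d G → ℝ} (hFc : Continuous F) (hFb : ∃ C, ∀ U, |F U| ≤ C) {ε : ℝ} (hε : 0 < ε) :
    ∀ᶠ n in atTop, ∀ η : LGConfig d G, |∫ U, F U ∂(perturbedYMS ρ β W (Λs n) η) - ∫ U, F U ∂μ| < ε :=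
  BoundaryLimit.eventually_forall_abs_sub_integral_lt (isSpecification_perturbedYMS ρ hρ β hB hWc hdep)
    (fun Λ _ hF _ hC => continuous_integral_perturbedYMS ρ hρ β hB hWc Λ hF hC) hsub hμ hcof hFc hFb hε

/-- **Wilson action (`W = 0`): limits of finite-volume Wilson–Gibbs distributions `γ_{Λₙ}(· | ηₙ)` with
ARBITRARY boundary fields are DLR states** — the tree's `mem_ymGibbsMeasures_of_mem_infiniteVolumeLimitPoints_holds`
is the periodic (torus) case; this is the Dirichlet-type case (Georgii 2011, Thm. 4.17). [folklore] -/
theorem mem_ymGibbsMeasures_of_tendsto (hρ : Continuous ρ) (β : ℝ)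
    {Λs : ℕ → Finset (ZdEdge d)} (hcof : ∀ Δ : Finset (ZdEdge d), ∀ᶠ n in atTop, Δ ⊆ Λs n)
    (ηs : ℕ → LGConfig d G) {μ : Measure (LGConfig d G)} [IsProbabilityMeasure μ]
    (hlim : ∀ F : LGConfig d G → ℝ, Continuous F → (∃ C, ∀ U, |F U| ≤ C) →
      Tendsto (fun n => ∫ U, F U ∂(ymSpecification ρ β (Λs n) (ηs n))) atTop (𝓝 (∫ U, F U ∂μ))) :
    μ ∈ ymGibbsMeasures (d := d) ρ β :=
  BoundaryLimit.isGibbsMeasure_of_tendsto_integral (isSpecification_ymSpecification_of_t2Space (d := d) ρ hρ β)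
    (fun Λ _ hF _ hC => continuous_integral_ymSpecification ρ hρ β Λ hF hC) hcof ηs hlim

/-- ★ **Wilson action, UNIQUENESS ⇒ EVERY BOUNDARY CONDITION CONVERGES TO THE ONE STATE**: if `𝒢(β)` is a
subsingleton containing `μ`, the finite-volume Wilson–Gibbs distributions with arbitrary boundary fields converge to
`μ` on every bounded continuous observable, full sequence. [folklore] -/
theorem tendsto_integral_ymSpecification_of_subsingleton (hρ : Continuous ρ) (β : ℝ)
    (hsub : (ymGibbsMeasures (d := d) ρ β).Subsingleton) {μ : Measure (LGConfig d G)}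
    (hμ : μ ∈ ymGibbsMeasures (d := d) ρ β)
    {Λs : ℕ → Finset (ZdEdge d)} (hcof : ∀ Δ : Finset (ZdEdge d), ∀ᶠ n in atTop, Δ ⊆ Λs n)
    (ηs : ℕ → LGConfig d G) {F : LGConfig d G → ℝ} (hFc : Continuous F) (hFb : ∃ C, ∀ U, |F U| ≤ C) :
    Tendsto (fun n => ∫ U, F U ∂(ymSpecification ρ β (Λs n) (ηs n))) atTop (𝓝 (∫ U, F U ∂μ)) :=
  BoundaryLimit.tendsto_integral_of_subsingleton (isSpecification_ymSpecification_of_t2Space (d := d) ρ hρ β)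
    (fun Λ _ hF _ hC => continuous_integral_ymSpecification ρ hρ β Λ hF hC) hsub hμ hcof ηs hFc hFb

/-- ★ **Wilson action, UNIFORMLY IN THE BOUNDARY CONDITION.** [folklore] -/
theorem eventually_forall_abs_sub_integral_ymSpecification_lt (hρ : Continuous ρ) (β : ℝ)
    (hsub : (ymGibbsMeasures (d := d) ρ β).Subsingleton) {μ : Measure (LGConfig d G)}
    (hμ : μ ∈ ymGibbsMeasures (d := d) ρ β)
    {Λs : ℕ → Finset (ZdEdge d)} (hcof : ∀ Δ : Finset (ZdEdge d), ∀ᶠ n in atTop, Δ ⊆ Λs n)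
    {F : LGConfig d G → ℝ} (hFc : Continuous F) (hFb : ∃ C, ∀ U, |F U| ≤ C) {ε : ℝ} (hε : 0 < ε) :
    ∀ᶠ n in atTop, ∀ η : LGConfig d G, |∫ U, F U ∂(ymSpecification ρ β (Λs n) η) - ∫ U, F U ∂μ| < ε :=
  BoundaryLimit.eventually_forall_abs_sub_integral_lt (isSpecification_ymSpecification_of_t2Space (d := d) ρ hρ β)
    (fun Λ _ hF _ hC => continuous_integral_ymSpecification ρ hρ β Λ hF hC) hsub hμ hcof hFc hFb hε

end Schemas

/-! ### The cell's currencies: one state, every boundary condition -/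

section Currencies

variable {d N : ℕ}

/-- ★★ **THE ONE STATE OF A MEMBER IS THE LIMIT OF EVERY BOUNDARY CONDITION** (tier 1, every `d`, `N`, `β`): under
`PerturbedMassGapAt d N β W supp` (continuous terms reading their own links, locally finite support) there is ONE
probability measure `μ` with `perturbedGibbsMeasures = {μ}`, and for every cofinal sequence of finite link volumes
`(Λₙ)`: (a) for EVERY sequence of boundary fields `(ηₙ)` and every bounded continuous `F`,
`∫ F dγ^W_{Λₙ}(· | ηₙ) → ∫ F dμ`; (b) uniformly: for every `ε > 0`, eventually `|∫ F dγ^W_{Λₙ}(· | η) − ∫ F dμ| < ε`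
for ALL `η` at once. [folklore] -/
theorem boundaryLimit_of_perturbedMassGapAt {β : ℝ} {W : Potential (ZdEdge d) (SUN N)}
    {supp : Finset (ZdEdge d) → Finset (Finset (ZdEdge d))} (hgap : PerturbedMassGapAt d N β W supp)
    (hWc : ∀ X, Continuous (W X)) (hdep : ∀ X, DependsOn (W X) (↑X : Set (ZdEdge d)))
    (hsupp : W.IsSupportedBy supp) :
    ∃ μ : Measure (LGConfig d (SUN N)),
      perturbedGibbsMeasures (d := d) (fundamentalRep (Fin N)) ((N : ℝ) * β) W supp = {μ} ∧
      ∀ Λs : ℕ → Finset (ZdEdge d), (∀ Δ : Finset (ZdEdge d), ∀ᶠ n in atTop, Δ ⊆ Λs n) →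
        (∀ (ηs : ℕ → LGConfig d (SUN N)) (F : LGConfig d (SUN N) → ℝ), Continuous F → (∃ C, ∀ U, |F U| ≤ C) →
          Tendsto (fun n => ∫ U, F U ∂(perturbedYM (fundamentalRep (Fin N)) ((N : ℝ) * β) W supp (Λs n) (ηs n)))
            atTop (𝓝 (∫ U, F U ∂μ))) ∧
        ∀ (F : LGConfig d (SUN N) → ℝ), Continuous F → (∃ C, ∀ U, |F U| ≤ C) → ∀ ε : ℝ, 0 < ε →
          ∀ᶠ n in atTop, ∀ η : LGConfig d (SUN N),
            |∫ U, F U ∂(perturbedYM (fundamentalRep (Fin N)) ((N : ℝ) * β) W supp (Λs n) η) - ∫ U, F U ∂μ| < ε := by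
  obtain ⟨hsub, ⟨μ, hμ⟩⟩ := hgap.1
  have hρ : Continuous (fundamentalRep (Fin N)) := continuous_fundamentalRep (Fin N)
  refine ⟨μ, Set.eq_singleton_iff_unique_mem.2 ⟨hμ, fun ν hν => hsub hν hμ⟩, fun Λs hcof => ⟨?_, ?_⟩⟩
  · exact fun ηs F hFc hFb =>
      tendsto_integral_perturbedYM_of_subsingleton _ hρ _ hWc hdep hsupp hsub hμ hcof ηs hFc hFb
  · exact fun F hFc hFb ε hε =>
      eventually_forall_abs_sub_integral_perturbedYM_lt _ hρ _ hWc hdep hsupp hsub hμ hcof hFc hFb hε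

/-- ★★ **BALL FORM** (gauge-invariant tier-1 `ℤ^d` ball): a `MassGapOnBallZdG d N β ε₀ ε₁ R` row gives, for EVERY
member `(W, supp) ∈ MemBallZdG ε₀ ε₁ R`, one state `μ` = the limit of the member's finite-volume Gibbs distributions
with every boundary condition (sequence form and uniform form). [folklore] -/
theorem boundaryLimit_onBallZdG {β ε₀ ε₁ : ℝ} {R : ℕ} (hgap : MassGapOnBallZdG d N β ε₀ ε₁ R)
    {W : Potential (ZdEdge d) (SUN N)} {supp : Finset (ZdEdge d) → Finset (Finset (ZdEdge d))}
    (hmem : MemBallZdG ε₀ ε₁ R W supp) :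
    ∃ μ : Measure (LGConfig d (SUN N)),
      perturbedGibbsMeasures (d := d) (fundamentalRep (Fin N)) ((N : ℝ) * β) W supp = {μ} ∧
      ∀ Λs : ℕ → Finset (ZdEdge d), (∀ Δ : Finset (ZdEdge d), ∀ᶠ n in atTop, Δ ⊆ Λs n) →
        (∀ (ηs : ℕ → LGConfig d (SUN N)) (F : LGConfig d (SUN N) → ℝ), Continuous F → (∃ C, ∀ U, |F U| ≤ C) →
          Tendsto (fun n => ∫ U, F U ∂(perturbedYM (fundamentalRep (Fin N)) ((N : ℝ) * β) W supp (Λs n) (ηs n)))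
            atTop (𝓝 (∫ U, F U ∂μ))) ∧
        ∀ (F : LGConfig d (SUN N) → ℝ), Continuous F → (∃ C, ∀ U, |F U| ≤ C) → ∀ ε : ℝ, 0 < ε →
          ∀ᶠ n in atTop, ∀ η : LGConfig d (SUN N),
            |∫ U, F U ∂(perturbedYM (fundamentalRep (Fin N)) ((N : ℝ) * β) W supp (Λs n) η) - ∫ U, F U ∂μ| < ε :=
  boundaryLimit_of_perturbedMassGapAt (hgap W supp hmem) hmem.continuous hmem.dependsOn hmem.supportedBy

/-- ★★ **TIER 2** (link-summable, possibly infinite-range members): under `PerturbedMassGapAtS d N β W` (continuous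
terms reading their own links, a summable link majorant) the one DLR state is the limit of the finite-volume Gibbs
distributions with every boundary condition (sequence form and uniform form). [folklore] -/
theorem boundaryLimit_of_perturbedMassGapAtS {β : ℝ} {W : Potential (ZdEdge d) (SUN N)}
    (hgap : PerturbedMassGapAtS d N β W) {B : Finset (ZdEdge d) → ℝ} (hB : IsLinkSummable W B)
    (hWc : ∀ X, Continuous (W X)) (hdep : ∀ X, DependsOn (W X) (↑X : Set (ZdEdge d))) :
    ∃ μ : Measure (LGConfig d (SUN N)),
      perturbedGibbsMeasuresS (d := d) (fundamentalRep (Fin N)) ((N : ℝ) * β) W = {μ} ∧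
      ∀ Λs : ℕ → Finset (ZdEdge d), (∀ Δ : Finset (ZdEdge d), ∀ᶠ n in atTop, Δ ⊆ Λs n) →
        (∀ (ηs : ℕ → LGConfig d (SUN N)) (F : LGConfig d (SUN N) → ℝ), Continuous F → (∃ C, ∀ U, |F U| ≤ C) →
          Tendsto (fun n => ∫ U, F U ∂(perturbedYMS (fundamentalRep (Fin N)) ((N : ℝ) * β) W (Λs n) (ηs n)))
            atTop (𝓝 (∫ U, F U ∂μ))) ∧
        ∀ (F : LGConfig d (SUN N) → ℝ), Continuous F → (∃ C, ∀ U, |F U| ≤ C) → ∀ ε : ℝ, 0 < ε →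
          ∀ᶠ n in atTop, ∀ η : LGConfig d (SUN N),
            |∫ U, F U ∂(perturbedYMS (fundamentalRep (Fin N)) ((N : ℝ) * β) W (Λs n) η) - ∫ U, F U ∂μ| < ε := by
  obtain ⟨hsub, ⟨μ, hμ⟩⟩ := hgap.1
  have hρ : Continuous (fundamentalRep (Fin N)) := continuous_fundamentalRep (Fin N)
  refine ⟨μ, Set.eq_singleton_iff_unique_mem.2 ⟨hμ, fun ν hν => hsub hν hμ⟩, fun Λs hcof => ⟨?_, ?_⟩⟩
  · exact fun ηs F hFc hFb =>
      tendsto_integral_perturbedYMS_of_subsingleton _ hρ _ hB hWc hdep hsub hμ hcof ηs hFc hFb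
  · exact fun F hFc hFb ε hε =>
      eventually_forall_abs_sub_integral_perturbedYMS_lt _ hρ _ hB hWc hdep hsub hμ hcof hFc hFb hε

/-- ★★ **TIER-2 BALL FORM**: a `MassGapOnBallZdS d N β a Λ t` row gives, for every member `W ∈ MemBallZdS a Λ t`, one
state = the limit of every boundary condition. [folklore] -/
theorem boundaryLimit_onBallZdS {β a Λ t : ℝ} (hgap : MassGapOnBallZdS d N β a Λ t)
    {W : Potential (ZdEdge d) (SUN N)} (hmem : MemBallZdS a Λ t W) :
    ∃ μ : Measure (LGConfig d (SUN N)),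
      perturbedGibbsMeasuresS (d := d) (fundamentalRep (Fin N)) ((N : ℝ) * β) W = {μ} ∧
      ∀ Λs : ℕ → Finset (ZdEdge d), (∀ Δ : Finset (ZdEdge d), ∀ᶠ n in atTop, Δ ⊆ Λs n) →
        (∀ (ηs : ℕ → LGConfig d (SUN N)) (F : LGConfig d (SUN N) → ℝ), Continuous F → (∃ C, ∀ U, |F U| ≤ C) →
          Tendsto (fun n => ∫ U, F U ∂(perturbedYMS (fundamentalRep (Fin N)) ((N : ℝ) * β) W (Λs n) (ηs n)))
            atTop (𝓝 (∫ U, F U ∂μ))) ∧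
        ∀ (F : LGConfig d (SUN N) → ℝ), Continuous F → (∃ C, ∀ U, |F U| ≤ C) → ∀ ε : ℝ, 0 < ε →
          ∀ᶠ n in atTop, ∀ η : LGConfig d (SUN N),
            |∫ U, F U ∂(perturbedYMS (fundamentalRep (Fin N)) ((N : ℝ) * β) W (Λs n) η) - ∫ U, F U ∂μ| < ε := by
  obtain ⟨B, hB⟩ := hmem.summable
  exact boundaryLimit_of_perturbedMassGapAtS (hgap W hmem) hB hmem.continuous hmem.dependsOn

/-- ★★ **WILSON ACTION** (`W = 0`; every `d`, `N`): under `MassGapAt d N β` the unique DLR state of `SU(N)` lattice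
Yang–Mills at tree coupling `N β` is the limit of the finite-volume Wilson–Gibbs distributions `γ_{Λₙ}(· | ηₙ)` for
EVERY sequence of boundary fields `ηₙ` along every cofinal `(Λₙ)`, on every bounded continuous observable, and
uniformly in the boundary field — the Dirichlet-type companion of the tree's periodic / free-boundary limits
(`hasUniqueInfiniteVolumeLimit_*`, `StrongCouplingPhaseAt`). [folklore] -/
theorem boundaryLimit_of_massGapAt {β : ℝ} (hgap : MassGapAt d N β) :
    ∃ μ : Measure (LGConfig d (SUN N)),
      ymGibbsMeasures (d := d) (fundamentalRep (Fin N)) ((N : ℝ) * β) = {μ} ∧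
      ∀ Λs : ℕ → Finset (ZdEdge d), (∀ Δ : Finset (ZdEdge d), ∀ᶠ n in atTop, Δ ⊆ Λs n) →
        (∀ (ηs : ℕ → LGConfig d (SUN N)) (F : LGConfig d (SUN N) → ℝ), Continuous F → (∃ C, ∀ U, |F U| ≤ C) →
          Tendsto (fun n => ∫ U, F U ∂(ymSpecification (fundamentalRep (Fin N)) ((N : ℝ) * β) (Λs n) (ηs n)))
            atTop (𝓝 (∫ U, F U ∂μ))) ∧
        ∀ (F : LGConfig d (SUN N) → ℝ), Continuous F → (∃ C, ∀ U, |F U| ≤ C) → ∀ ε : ℝ, 0 < ε →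
          ∀ᶠ n in atTop, ∀ η : LGConfig d (SUN N),
            |∫ U, F U ∂(ymSpecification (fundamentalRep (Fin N)) ((N : ℝ) * β) (Λs n) η) - ∫ U, F U ∂μ| < ε := by
  obtain ⟨hsub, ⟨μ, hμ⟩⟩ := hgap.1
  have hρ : Continuous (fundamentalRep (Fin N)) := continuous_fundamentalRep (Fin N)
  refine ⟨μ, Set.eq_singleton_iff_unique_mem.2 ⟨hμ, fun ν hν => hsub hν hμ⟩, fun Λs hcof => ⟨?_, ?_⟩⟩
  · exact fun ηs F hFc hFb =>
      tendsto_integral_ymSpecification_of_subsingleton _ hρ _ hsub hμ hcof ηs hFc hFb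
  · exact fun F hFc hFb ε hε =>
      eventually_forall_abs_sub_integral_ymSpecification_lt _ hρ _ hsub hμ hcof hFc hFb hε

end Currencies


/-! ### Appendix (ds-3 g11, same day): the net `Λ ↑ ℤ^d` of all finite volumes, in the currencies -/

section Net

variable {d N : ℕ}

/-- ★★ **TIER 1, ALONG THE NET OF ALL FINITE VOLUMES**: under `PerturbedMassGapAt d N β W supp` (continuous terms reading
their own links, locally finite support) the one DLR state `μ` satisfies: for every bounded continuous `F`, (a) for EVERY
assignment `Λ ↦ η_Λ` of boundary fields, `∫ F dγ^W_Λ(· | η_Λ) → ∫ F dμ` as `Λ ↑ ℤ^d` along the directed set of finite link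
sets; (b) for every `ε > 0`, for all sufficiently large `Λ` and ALL `η` at once, `|∫ F dγ^W_Λ(· | η) − ∫ F dμ| < ε`. [folklore] -/
theorem boundaryLimitNet_of_perturbedMassGapAt {β : ℝ} {W : Potential (ZdEdge d) (SUN N)}
    {supp : Finset (ZdEdge d) → Finset (Finset (ZdEdge d))} (hgap : PerturbedMassGapAt d N β W supp)
    (hWc : ∀ X, Continuous (W X)) (hdep : ∀ X, DependsOn (W X) (↑X : Set (ZdEdge d)))
    (hsupp : W.IsSupportedBy supp) :
    ∃ μ : Measure (LGConfig d (SUN N)),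
      perturbedGibbsMeasures (d := d) (fundamentalRep (Fin N)) ((N : ℝ) * β) W supp = {μ} ∧
      ∀ (F : LGConfig d (SUN N) → ℝ), Continuous F → (∃ C, ∀ U, |F U| ≤ C) →
        (∀ ηΛ : Finset (ZdEdge d) → LGConfig d (SUN N),
          Tendsto (fun Λ : Finset (ZdEdge d) =>
            ∫ U, F U ∂(perturbedYM (fundamentalRep (Fin N)) ((N : ℝ) * β) W supp Λ (ηΛ Λ))) atTop (𝓝 (∫ U, F U ∂μ))) ∧
        ∀ ε : ℝ, 0 < ε → ∀ᶠ Λ : Finset (ZdEdge d) in atTop, ∀ η : LGConfig d (SUN N),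
          |∫ U, F U ∂(perturbedYM (fundamentalRep (Fin N)) ((N : ℝ) * β) W supp Λ η) - ∫ U, F U ∂μ| < ε := by
  obtain ⟨hsub, ⟨μ, hμ⟩⟩ := hgap.1
  have hρ : Continuous (fundamentalRep (Fin N)) := continuous_fundamentalRep (Fin N)
  have hspec := isSpecification_perturbedYM (d := d) (fundamentalRep (Fin N)) hρ ((N : ℝ) * β)
    (fun X => ⟨hdep X, (hWc X).measurable⟩) (fun X => exists_bound_of_continuous (hWc X)) hsupp
  refine ⟨μ, Set.eq_singleton_iff_unique_mem.2 ⟨hμ, fun ν hν => hsub hν hμ⟩, fun F hFc hFb => ⟨fun ηΛ => ?_, fun ε hε => ?_⟩⟩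
  · exact BoundaryLimit.tendsto_integral_atTop_of_subsingleton hspec
      (fun Λ _ hF _ hC => continuous_integral_perturbedYM _ hρ _ hWc supp Λ hF hC) hsub hμ ηΛ hFc hFb
  · exact BoundaryLimit.eventually_atTop_forall_abs_sub_integral_lt hspec
      (fun Λ _ hF _ hC => continuous_integral_perturbedYM _ hρ _ hWc supp Λ hF hC) hsub hμ hFc hFb hε

/-- ★★ **WILSON ACTION, ALONG THE NET OF ALL FINITE VOLUMES** (every `d`, `N`): under `MassGapAt d N β` the unique DLR state
of `SU(N)` lattice Yang–Mills at tree coupling `N β` is the limit, as `Λ ↑ ℤ^d` along the directed set of finite volumes, of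
the finite-volume Wilson–Gibbs distributions with ANY boundary fields `η_Λ`, and uniformly in the boundary field. [folklore] -/
theorem boundaryLimitNet_of_massGapAt {β : ℝ} (hgap : MassGapAt d N β) :
    ∃ μ : Measure (LGConfig d (SUN N)),
      ymGibbsMeasures (d := d) (fundamentalRep (Fin N)) ((N : ℝ) * β) = {μ} ∧
      ∀ (F : LGConfig d (SUN N) → ℝ), Continuous F → (∃ C, ∀ U, |F U| ≤ C) →
        (∀ ηΛ : Finset (ZdEdge d) → LGConfig d (SUN N),
          Tendsto (fun Λ : Finset (ZdEdge d) =>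
            ∫ U, F U ∂(ymSpecification (fundamentalRep (Fin N)) ((N : ℝ) * β) Λ (ηΛ Λ))) atTop (𝓝 (∫ U, F U ∂μ))) ∧
        ∀ ε : ℝ, 0 < ε → ∀ᶠ Λ : Finset (ZdEdge d) in atTop, ∀ η : LGConfig d (SUN N),
          |∫ U, F U ∂(ymSpecification (fundamentalRep (Fin N)) ((N : ℝ) * β) Λ η) - ∫ U, F U ∂μ| < ε := by
  obtain ⟨hsub, ⟨μ, hμ⟩⟩ := hgap.1
  have hρ : Continuous (fundamentalRep (Fin N)) := continuous_fundamentalRep (Fin N)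
  have hspec := isSpecification_ymSpecification_of_t2Space (d := d) (fundamentalRep (Fin N)) hρ ((N : ℝ) * β)
  refine ⟨μ, Set.eq_singleton_iff_unique_mem.2 ⟨hμ, fun ν hν => hsub hν hμ⟩, fun F hFc hFb => ⟨fun ηΛ => ?_, fun ε hε => ?_⟩⟩
  · exact BoundaryLimit.tendsto_integral_atTop_of_subsingleton hspec
      (fun Λ _ hF _ hC => continuous_integral_ymSpecification _ hρ _ Λ hF hC) hsub hμ ηΛ hFc hFb
  · exact BoundaryLimit.eventually_atTop_forall_abs_sub_integral_lt hspec
      (fun Λ _ hF _ hC => continuous_integral_ymSpecification _ hρ _ Λ hF hC) hsub hμ hFc hFb hε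

end Net

end Summit.Ventures.YMGap.RobustBall

end
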